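import Summits.Ventures.CertifiedManyBodySolver.Certificates.HubbardSquare_tpm3o10_U29o5_toyKernelCert_pauliRowTB
import Summits.Ventures.CertifiedManyBodySolver.Rows.CorrWindowCertKernelChain
import HarnessLib

/-!
# STEP-0 of the STAGED «tier P» replay: the two-level Pauli toy (`Re ω(1 − n_{0↓}) ≥ 0` at the La214-E station `(1, −3/10, 29/5)`)
# replayed as an ENCODED MERGE CHAIN — 7 residual slices regrouped `[1, 2, 2 | rest]` into 4 steps, each step ONE `decide +kernel`
# on `eval%` literals, assembled by pattern matching on `Fin 4`, through `affineOrbitLowerRowN_of_chainKernelCertTB` — ZERO hypotheses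

HONEST FRAMING: a TOY (the Pauli bound is textbook) and a TEMPLATE: this is the exact shape a real staged vertex replay takes
(`Rows/CorrWindowCertKernelChain.lean`, item (v′)): slices `groupSlices (residTGslices … (gramTBslices K blocks) …) ns`, accumulator
literals `C_i` produced at elaboration time by `eval%` and RE-CHECKED by the kernel (`…_step_i : Cs.getD (i+1) [] = stepE B (Cs.getD i [])
(slices.getD i [])`, Boolean equality of encoded polynomials decided by the kernel, `eq_of_beq`), the `ChainOK` record assembled by the
`Fin M` pattern-match idiom of `CertifiedQuantumChemistry/Certificates/HubbardRingL10U10055DQGKernelLower.lean`, and ONE final rational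
inequality on the last accumulator. Here the residual `(1 − n_{0↓}) − Σ_{ij}(R Rᵀ)_{ij}/4 · vᵢ†vⱼ` cancels completely (`n² = n`), so the
last accumulator is the EMPTY encoded polynomial and the inequality is `0 ≤ 0`. Trust base: the Lean kernel (std axioms; no
`native_decide`). No number of record; no existing claim node discharged; CONTROL/CALIBRATION context (wording (xx1)); silent on
ρ_s = 0 / presence / T_c / phase; nothing about La₂CuO₄; no summit statement is proved by this file. Seat hubbard-obs-p2 (STIFFNESS),
`prover-hubbard-obs-p2-g23-0`, zero compute.

References: J. Wang et al., PRX 14 (2024) 031006 §III [WangEtAl2024]; X. Han, arXiv:2006.06002 §2 eq. (2) [Han2020Bootstrap];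
C. Jansson, D. Chaykin, C. Keil, SIAM J. Numer. Anal. 46 (2008) 180 [JanssonChaykinKeil2008].
-/

namespace Summit.Ventures.CertifiedManyBodySolver

namespace CARPolyWindow

namespace Toy3x3

open Summit.Ventures.CertifiedQuantumChemistry Summit.Ventures.CertifiedQuantumChemistry.CARPoly
open Literature.MathematicalPhysics.QuantumLattice Literature.MathematicalPhysics.QuantumLattice.HubbardWave0
open Literature.MathematicalPhysics.QuantumManyBody.StateRelaxation
open Literature.Probability.LatticeModels ThermodynamicLimit Filter Topology
open Matrix
open scoped ComplexOrder BigOperators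

/-! ## The sliced residual of the two-level toy certificate and its regrouping -/

/-- The 7 slices of the two-level toy residual (head; 4 Gram pair slices of the one 2 × 2 block; no eom / symmetry slices; charged
words; anti-Hermitian parts), regrouped `[1, 2, 2 | rest]` into 4 chain slices (the last one is EMPTY — exercised on purpose).
[cite: WangEtAl2024, §III] -/
def toySlices : List (Terms (Orb (Fin 9))) :=
  groupSlices (residTGslices TXd (fun _ => 0) 0 (fun σ => orb (ix 0) σ) 0 0 0 0 TE (gramTBslices 1 blocksd) TH
    (fun b : Fin 0 => b.elim0) [] (fun l : Fin 0 => l.elim0) (fun l : Fin 0 => l.elim0) [] []) [1, 2, 2]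

/-! ## The accumulators (elaboration-time literals) and the per-step KERNEL facts -/

/-- Accumulator after step 1 (the head slice `1 − n_{0↓}` + zero-weighted density/energy rows): `eval%` literal. [folklore] -/
def toyC1 : SOSDual.EncPoly := eval% stepE 32 ([] : SOSDual.EncPoly) (toySlices.getD 0 [])

/-- Accumulator after step 2 (Gram pairs `(1,1)`, `(1,2)`): `eval%` literal. [folklore] -/
def toyC2 : SOSDual.EncPoly := eval% stepE 32 toyC1 (toySlices.getD 1 [])

/-- Accumulator after step 3 (Gram pairs `(2,1)`, `(2,2)` — the normaliser finds `n² = n`): `eval%` literal. [folklore] -/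
def toyC3 : SOSDual.EncPoly := eval% stepE 32 toyC2 (toySlices.getD 2 [])

/-- Accumulator after step 4 (the empty tail slice): `eval%` literal. [folklore] -/
def toyC4 : SOSDual.EncPoly := eval% stepE 32 toyC3 (toySlices.getD 3 [])

/-- The accumulator list `[C₀ = [], C₁, C₂, C₃, C₄]`. [folklore] -/
def toyCs : List SOSDual.EncPoly := [[], toyC1, toyC2, toyC3, toyC4]

/-- KERNEL FACT, step 1 of 4: the literal IS the merge step (Boolean structural equality decided by the kernel). [folklore] -/
theorem toyChain_step_0 : toyCs.getD (0 + 1) [] = stepE 32 (toyCs.getD 0 []) (toySlices.getD 0 []) :=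
  eq_of_beq (by decide +kernel)

/-- KERNEL FACT, step 2 of 4. [folklore] -/
theorem toyChain_step_1 : toyCs.getD (1 + 1) [] = stepE 32 (toyCs.getD 1 []) (toySlices.getD 1 []) :=
  eq_of_beq (by decide +kernel)

/-- KERNEL FACT, step 3 of 4. [folklore] -/
theorem toyChain_step_2 : toyCs.getD (2 + 1) [] = stepE 32 (toyCs.getD 2 []) (toySlices.getD 2 []) :=
  eq_of_beq (by decide +kernel)

/-- KERNEL FACT, step 4 of 4. [folklore] -/
theorem toyChain_step_3 : toyCs.getD (3 + 1) [] = stepE 32 (toyCs.getD 3 []) (toySlices.getD 3 []) :=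
  eq_of_beq (by decide +kernel)

/-- **The chain record**, assembled by pattern matching on `Fin 4` (no computation here). [cite: JanssonChaykinKeil2008, §3] -/
theorem toyChain_ok : ChainOK 32 4 toyCs toySlices where
  len := by decide +kernel
  step i := match i with
    | ⟨0, _⟩ => toyChain_step_0
    | ⟨1, _⟩ => toyChain_step_1
    | ⟨2, _⟩ => toyChain_step_2
    | ⟨3, _⟩ => toyChain_step_3
    | ⟨n + 4, h⟩ => absurd h (by omega)

/-- **The ONE rational inequality on the last accumulator**: `0 ≤ lowerConst (decPoly 9 C₄) + 0` (here `C₄ = []`, so `= 0`).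
Decided by the kernel. [cite: WangEtAl2024, §III] -/
theorem toyChain_lowerConst :
    (0 : ℚ) ≤ lowerConst (SOSDual.decPoly 9 (toyCs.getD 4 [])) + (0 + 0) * ((7 / 8 : ℚ) / 2 - 0) := by
  decide +kernel

/-! ## The end-to-end theorem -/

/-- Membership-proof irrelevance for ordered sites. [folklore] -/
private theorem pt_congr_site₅ {x y : Site 2} (hx : x ∈ W) (hy : y ∈ W) (h : x = y) :
    PolySite.pt x hx = PolySite.pt y hy := by
  subst h; rfl

/-- **STEP-0, staged edition: the affine-N claim-node predicate for `1 − n_{0↓}` at the La214-E station `(1, −3/10, 29/5)`, value `0`,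
from the 4-step ENCODED MERGE CHAIN over the sliced two-level certificate — ZERO hypotheses.** [cite: WangEtAl2024, §III] -/
theorem toyChain_affineOrbitLowerRowN :
    SquareTTPrimeCorrAffineOrbitLowerRowN (((-3 / 10 : ℚ)) : ℝ) (((29 / 5 : ℚ)) : ℝ) 0 0 0 0 0 0 (7 / 8) {1} W (termOp d TXd) := by
  have hz : (0 : Site 2) ∈ W := zero_mem_thicken_zero 1
  have h1 : (1 : DihedralGroup 4) ∈ ({1} : Finset (DihedralGroup 4)) := Finset.mem_singleton_self 1
  have hmul : ∀ a ∈ ({1} : Finset (DihedralGroup 4)), ∀ b ∈ ({1} : Finset (DihedralGroup 4)),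
      a * b ∈ ({1} : Finset (DihedralGroup 4)) := by
    intro a ha b hb
    rw [Finset.mem_singleton] at ha hb ⊢
    rw [ha, hb, mul_one]
  have hΛ : ({0} : Finset (Site 2)) ⊆ W := Finset.singleton_subset_iff.2 hz
  have hix0 : xs (ix 0) = 0 := xs_ix_of_mem 0 hz
  have ho : ∀ σ : Fin 2, d (orb (ix 0) σ) = orb (PolySite.pt 0 hz) σ := by
    intro σ
    rw [d_orb, pt_congr_site₅ (xs_mem (ix 0)) hz hix0]
  have hH : termOp d TH = (hubbardTTPrimeFermionInteraction 1 (((-3 / 10 : ℚ)) : ℝ) (((29 / 5 : ℚ)) : ℝ)).localHamiltonian W := by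
    rw [TH, termOp_hamTermsIdx 1 (-3 / 10) (29 / 5) xs xs_mem xs_injective xs_cover d d_orb, Rat.cast_one]
  have hE : termOp d TE = fermionEmbed (PolySite.incl (subset_refl W))
      ((hubbardTTPrimeFermionInteraction 1 (((-3 / 10 : ℚ)) : ℝ) (((29 / 5 : ℚ)) : ℝ)).meanEnergyObs 1) := by
    rw [TE, termOp_energyTermsIdx 1 (-3 / 10) (29 / 5) xs xs_mem (subset_refl W) ix xs_ix_of_mem d d_orb, Rat.cast_one]
  exact affineOrbitLowerRowN_of_chainKernelCertTB (-3 / 10) (29 / 5) (by norm_num) hΛ (subset_refl W) (subset_refl W) hz h1 hmul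
    d d_injective 32 (fun b : Fin 0 => b.elim0) (fun b : Fin 0 => b.elim0) (fun b => b.elim0)
    (fun p => (ofLex p).2) (fun _ => rfl) TH hH TE hE (fun σ => orb (ix 0) σ) ho TXd (fun _ => 0) 0 0 0 0 0 1 blocksd []
    (fun l : Fin 0 => l.elim0) (fun l => l.elim0) (fun l : Fin 0 => l.elim0) (fun l : Fin 0 => l.elim0)
    (fun l => l.elim0) (fun l => l.elim0) (fun l : Fin 0 => l.elim0) [] (fun wc hwc => absurd hwc (List.not_mem_nil)) []
    [1, 2, 2] 4 toyCs rfl toyChain_ok (by norm_num) toyChain_lowerConst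

/- The plain torus-limit sentence `0 ≤ Re ω(1 − n_{0↓})` follows from `toyChain_affineOrbitLowerRowN` word for word as in
`toyTB_pauli_row` (`…_pauliRowTB.lean`); it is not restated here (same statement, already landed). -/

end Toy3x3

end CARPolyWindow

end Summit.Ventures.CertifiedManyBodySolver
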